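import Literature.IUT.LogThetaLattice.GlobalPacketsLGP
import Literature.AlgebraicGeometry.Frobenioids.MonoidRealification

/-!
# Bridge: the realified single packet monoid `Ψ^ℝ_{log(^{A,α}𝓕_v)}` ([IUTchIII] Proposition 3.4 (i))

abc-iut cell, layer L6, MERGE-MAP v3 §8 row **B7** (map writer abc-iut-L6-t7; bridge seat abc-iut-L6-d6;
natural owner abc-iut-L6-t4, first refusal offered 2026-08-25T20:2xZ). Mochizuki, *Inter-universal
Teichmüller Theory III*, Prop. 3.4 (i), kurims p. 102: "the operation of forming the image via the natural
homomorphism `log(^α𝓕_v) → log(^{A,α}𝓕_v)` of the monoid `Ψ_{log(^α𝓕_v)}`, together with its submonoid of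
units `Ψ^×_{log(^α𝓕_v)}` and realification `Ψ^ℝ_{log(^α𝓕_v)}`, determines monoids `Ψ_{log(^{A,α}𝓕_v)}`,
`Ψ^×_{log(^{A,α}𝓕_v)}`, `Ψ^ℝ_{log(^{A,α}𝓕_v)}`". abc-iut-L6-t4's `GlobalPacketsLGP.lean` (p403901) typed the
first two (`singlePacketMonoid`, `singlePacketUnits`) and left the realified one out, its docstring
recording "needs the realification functor of [FrdI] (TODO-merge: abc-iut-L1 …)". That functor is now
abc-iut-L1-t2's `Literature.AlgebraicGeometry.Frobenioids.Realification` (`M ⊗ ℝ_{≥0}` as the double dual,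
[FrdI] §0 p. 10; MonoidRealification.lean p403951, BUILT). This file gives `Ψ^ℝ` its referent —
`singlePacketRealified ι Ψ := Realification ↥(singlePacketMonoid ι Ψ)` — together with the natural map
from the realification of `Ψ` induced by `Ψ ↠ ι(Ψ)` and its compatibility with the canonical maps
`M → M ⊗ ℝ_{≥0}`. No typer file is edited. [claim: Mochizuki2012, status: disputed]
-/

namespace Literature.IUT.LogThetaLattice

open Literature.AlgebraicGeometry.Frobenioids

universe u

variable {𝕜 : Type u} [Field 𝕜] {Lv : Type u} [CommRing Lv] [Algebra 𝕜 Lv]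
variable {Pv : Type u} [CommRing Pv] [Algebra 𝕜 Pv]

/-- **IUTchIII:Prop3.4(i)** (kurims p.102) the realified single packet monoid
`Ψ^ℝ_{log(^{A,α}𝓕_v)} := Ψ_{log(^{A,α}𝓕_v)} ⊗ ℝ_{≥0}` — the [FrdI] §0 realification (`Frobenioids.Realification`)
of the image monoid `singlePacketMonoid ι Ψ`. [claim: Mochizuki2012, status: disputed] -/
def singlePacketRealified (ι : Lv →ₐ[𝕜] Pv) (Ψ : Submonoid Lv) : Type u :=
  Realification ↥(singlePacketMonoid ι Ψ)

/-- `Ψ^ℝ_{log(^{A,α}𝓕_v)}` is a commutative monoid. [claim: Mochizuki2012, status: disputed] -/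
instance singlePacketRealified.instCommMonoid (ι : Lv →ₐ[𝕜] Pv) (Ψ : Submonoid Lv) :
    CommMonoid (singlePacketRealified ι Ψ) :=
  inferInstanceAs (CommMonoid (Realification ↥(singlePacketMonoid ι Ψ)))

/-- The homomorphism `Ψ_{log(^α𝓕_v)} ↠ Ψ_{log(^{A,α}𝓕_v)}` "forming the image via the natural homomorphism"
(restriction of `ι` to `Ψ`, onto its image). [claim: Mochizuki2012, status: disputed] -/
def toSinglePacketMonoid (ι : Lv →ₐ[𝕜] Pv) (Ψ : Submonoid Lv) : ↥Ψ →* ↥(singlePacketMonoid ι Ψ) :=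
  (ι : Lv →* Pv).submonoidMap Ψ

/-- `Ψ ↠ ι(Ψ)` is surjective. [claim: Mochizuki2012, status: disputed] -/
theorem toSinglePacketMonoid_surjective (ι : Lv →ₐ[𝕜] Pv) (Ψ : Submonoid Lv) :
    Function.Surjective (toSinglePacketMonoid ι Ψ) :=
  (ι : Lv →* Pv).submonoidMap_surjective Ψ

/-- On underlying elements `toSinglePacketMonoid` is `ι`. [claim: Mochizuki2012, status: disputed] -/
@[simp] theorem coe_toSinglePacketMonoid (ι : Lv →ₐ[𝕜] Pv) (Ψ : Submonoid Lv) (x : Ψ) :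
    ((toSinglePacketMonoid ι Ψ x : ↥(singlePacketMonoid ι Ψ)) : Pv) = ι x := rfl

/-- The canonical map `Ψ_{log(^{A,α}𝓕_v)} → Ψ^ℝ_{log(^{A,α}𝓕_v)}` (`M → M ⊗ ℝ_{≥0}`).
[claim: Mochizuki2012, status: disputed] -/
def singlePacketRealified.of (ι : Lv →ₐ[𝕜] Pv) (Ψ : Submonoid Lv) :
    ↥(singlePacketMonoid ι Ψ) →* singlePacketRealified ι Ψ :=
  Realification.of _

/-- **Realification of "forming the image"**: the homomorphism
`Ψ^ℝ_{log(^α𝓕_v)} → Ψ^ℝ_{log(^{A,α}𝓕_v)}` induced (functoriality of `⊗ ℝ_{≥0}`, [FrdI] §0) by `Ψ ↠ ι(Ψ)`.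
[claim: Mochizuki2012, status: disputed] -/
def singlePacketRealified.map (ι : Lv →ₐ[𝕜] Pv) (Ψ : Submonoid Lv) :
    Realification ↥Ψ →* singlePacketRealified ι Ψ :=
  Realification.map (toSinglePacketMonoid ι Ψ)

/-- Compatibility of the realified map with the canonical maps `M → M ⊗ ℝ_{≥0}`:
`(Ψ ⊗ ℝ_{≥0} → ι(Ψ) ⊗ ℝ_{≥0}) ∘ of = of ∘ (Ψ ↠ ι(Ψ))`. [claim: Mochizuki2012, status: disputed] -/
theorem singlePacketRealified.map_of (ι : Lv →ₐ[𝕜] Pv) (Ψ : Submonoid Lv) (x : Ψ) :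
    singlePacketRealified.map ι Ψ (Realification.of _ x) =
      singlePacketRealified.of ι Ψ (toSinglePacketMonoid ι Ψ x) :=
  Realification.map_of _ _

/-- The units `Ψ^×_{log(^{A,α}𝓕_v)}` map into the realified monoid through `Ψ_{log(^{A,α}𝓕_v)}`
(`singlePacketUnits ≤ singlePacketMonoid`, t4). [claim: Mochizuki2012, status: disputed] -/
def singlePacketRealified.ofUnits (ι : Lv →ₐ[𝕜] Pv) (Ψ : Submonoid Lv) :
    ↥(singlePacketUnits ι Ψ) →* singlePacketRealified ι Ψ :=
  (singlePacketRealified.of ι Ψ).comp (Submonoid.inclusion (singlePacketUnits_le ι Ψ))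

end Literature.IUT.LogThetaLattice
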